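import Summits.RiemannHypothesis.RiemannHypothesis.Theorems.GroundBartaPolarPerronFrobeniusEvenFloorPrelim
import Summits.RiemannHypothesis.RiemannHypothesis.Theorems.GroundBartaGroundBartaFloorBarta
import Summits.RiemannHypothesis.RiemannHypothesis.Theorems.WeilParityEvenWinsBeyondArchStubSectorContinuity
import Literature.NumberTheory.LFunctions.WeilEvenGroundState
import HarnessLib

/-!
# The EVEN-SECTOR Barta floor (route `RiemannHypothesis/GroundBarta`; rung 3
`PolarPerronFrobenius`, stmt-RiemannHypothesis-18390 — even-sector twin of the rung
`GroundBartaFloor`, stmt-RiemannHypothesis-18389)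

`neg_groundBartaRate_le_weilEvenGroundEnergy`: at EVERY window `a > 0` carrying an EVEN-SECTOR
bottom state `u` (`Literature.NumberTheory.LFunctions.IsWeilEvenGroundState a u`: `L²`-limit of an
`L²`-normalised sequence of EVEN window tests minimising among EVEN window tests) that is real and
`≥ 0` a.e. on `(-a, a)`, the even-sector bottom is floored by Barta's rate:

  `ε_ev(a) ≥ -e(a)`,  `e(a) = groundBartaRate a = 2ϖ_a cosh(a/2)/Φ(a)`,
  `ϖ_a = ∫_{s>a} Φ(s)·2cosh(s/2) ds`,  `Φ = weilThetaPhi` (Riemann's kernel, `Φ̂ = ξ`).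

This is the rung `GroundBartaFloor` (Theorems/GroundBartaGroundBartaFloorBarta.lean, full form,
`IsWeilGroundState`) with the minimisation class RESTRICTED TO THE EVEN SECTOR: the probe — the
outer smooth cut-off `k_η = Φ χ_η` of Riemann's kernel — is EVEN, so the competitors `gₙ + t k_η`
of an even minimising sequence stay in the even sector of the larger window `b = a + η`, where
Cauchy–Schwarz for the shifted form `Re Q − ε_ev(b)‖·‖²` holds
(`evenFloor_re_weilFunctional_sub_sqrt_le_even`); harmonic splitting (`stub_harmonicSplit`:
`W(gₙ ⋆ k̃_η) = -W(gₙ ⋆ κ̃_η)`, `κ_η = Φ(1 - χ_η)`), the leakage limit along the sequence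
(`evenFloor_leakageTendsto`, no minimising property needed), the leakage sign for the non-negative
representative (`stub_leakageSign`: `Re W(v ⋆ κ̃_η) ≤ 2 c(v) ϖ_a`), the uniform energy bound of
the cut-offs (`stub_cutoffEnergyBound`) and `η → 0⁺` through the continuity of `ε_ev`
(`stub_sectorContinuity_continuousAt_even`, Bombieri Thm 5) give `ε_ev(a) ∫vΦ ≥ -2c(v)ϖ_a ≥
-e(a) ∫vΦ` exactly as in the full form.  No parity-order hypothesis (`EW a`) and no statement about
the FULL bottom enter: the hypothesis is strictly weaker than "the full form has a one-signed
ground state" (an even one-signed full ground state is an even-sector bottom state, and at an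
even-winning window conversely).  RH-free.

Consequences (Theorems/GroundBartaPolarPerronFrobeniusEvenSectorDeciding.lean): the parity-free
deciding theorem "cofinally some window carries a one-signed EVEN-SECTOR bottom state ⇒ RH", and
the items `EvenBartaFloor` / `EvenFloorDecay` of the draft route `EvenSectorBarta` up to unfolding.
References: Bombieri 2000 §4 (Problem 2, Lemma 1, Thm 3, Thm 5); Barta 1937 (floor from a
positive supersolution) via López-Gómez, doi:10.1142/8664 p.175.
-/

set_option linter.dupNamespace false

noncomputable section

open Set MeasureTheory Filter Complex
open scoped Real Topology ComplexConjugate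

namespace Summit.RiemannHypothesis.RiemannHypothesis.Theorems.PolarPerronFrobenius

open Literature.NumberTheory.LFunctions Literature.Analysis.Calculus
open Summit.RiemannHypothesis.RiemannHypothesis.Theorems.GroundStatesConvergeToXi
open Summit.RiemannHypothesis.RiemannHypothesis.Theorems.GroundBartaFloor

/-! ## Barta's inequality at a good window, even sector -/

/-- **The even-sector floor at a good window.**  If the window `a > 0` carries an even-sector
bottom state `u` (`IsWeilEvenGroundState a u`) with `Im u = 0`, `Re u ≥ 0` a.e. on `(-a, a)`, then
`ε_ev(a) ≥ -e(a)`, `e(a) = groundBartaRate a = 2ϖ_a cosh(a/2)/Φ(a)`.  The proof of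
`GroundBartaFloor.neg_groundBartaRate_le_weilGroundEnergy` run inside the even sector (even probe,
even competitors, `ε_ev` in place of `ε`). [cite: Bombieri2000Weil, §4 Lemma 1] -/
theorem neg_groundBartaRate_le_weilEvenGroundEnergy {a : ℝ} (ha : 0 < a) {u : ℝ → ℂ}
    (hu : IsWeilEvenGroundState a u)
    (hsign : ∀ᵐ t : ℝ, t ∈ Ioo (-a) a → (u t).im = 0 ∧ 0 ≤ (u t).re) :
    -groundBartaRate a ≤ weilEvenGroundEnergy a := by
  -- adapted from `GroundBartaFloor.neg_groundBartaRate_le_weilGroundEnergy` (full form)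
  have hu2 : MemLp u 2 := hu.memLp
  obtain ⟨g, hg, hQ, hL⟩ := hu.exists_tendsto
  have hg' : ∀ n, IsWeilTest (g n) ∧ tsupport (g n) ⊆ Icc (-a) a := fun n =>
    ⟨(hg n).1, (hg n).2.1⟩
  /- (0) the non-negative real representative `v` of `u` -/
  set v : ℝ → ℝ := (Ioo (-a) a).indicator fun t => max (u t).re 0 with hv
  have hv0 : ∀ t, 0 ≤ v t := fun t => by
    by_cases ht : t ∈ Ioo (-a) a
    · simp only [hv, indicator_of_mem ht]; exact le_max_right _ _
    · simp only [hv, indicator_of_notMem ht]; exact le_rfl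
  have hvs' : ∀ t, t ∉ Ioo (-a) a → v t = 0 := fun t ht => by
    simp only [hv, indicator_of_notMem ht]
  have hvs : ∀ t, t ∉ Icc (-a) a → v t = 0 := fun t ht =>
    hvs' t fun h => ht (Ioo_subset_Icc_self h)
  have hv_le : ∀ t, |v t| ≤ ‖u t‖ := fun t => by
    by_cases ht : t ∈ Ioo (-a) a
    · simp only [hv, indicator_of_mem ht]
      rw [abs_of_nonneg (le_max_right _ _)]
      exact max_le (Complex.re_le_norm _) (norm_nonneg _)
    · simp only [hv, indicator_of_notMem ht, abs_zero]; exact norm_nonneg _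
  have hnull : (volume : Measure ℝ) {-a, a} = 0 := (Set.toFinite _).measure_zero volume
  have hae2 := measure_eq_zero_iff_ae_notMem.1 hnull
  have hIoo_of : ∀ t : ℝ, t ∉ ({-a, a} : Set ℝ) → t ∈ Icc (-a) a → t ∈ Ioo (-a) a := by
    intro t ht hm
    simp only [mem_insert_iff, mem_singleton_iff, not_or] at ht
    exact ⟨lt_of_le_of_ne hm.1 (fun h => ht.1 h.symm), lt_of_le_of_ne hm.2 (fun h => ht.2 h)⟩
  have hae : u =ᵐ[volume] fun t => ((v t : ℝ) : ℂ) := by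
    filter_upwards [hsign, hu.ae_eq_zero_of_notMem, hae2] with t h1 h2 h3
    by_cases ht : t ∈ Ioo (-a) a
    · obtain ⟨him, hre⟩ := h1 ht
      simp only [hv, indicator_of_mem ht, max_eq_left hre]
      exact Complex.ext (by simp) (by simp [him])
    · have hm : t ∉ Icc (-a) a := fun hm => ht (hIoo_of t h3 hm)
      simp only [hv, indicator_of_notMem ht, h2 hm, Complex.ofReal_zero]
  have hv_meas : AEStronglyMeasurable v volume := by
    have h1 : AEStronglyMeasurable (fun t => max (u t).re 0) volume :=
      (Complex.continuous_re.comp_aestronglyMeasurable hu2.1).sup aestronglyMeasurable_const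
    exact h1.indicator measurableSet_Ioo
  have hv_int : Integrable v :=
    Integrable.mono' hu.integrable.norm hv_meas (Eventually.of_forall fun t => by
      rw [Real.norm_eq_abs]; exact hv_le t)
  set uc : ℝ → ℂ := fun t => ((v t : ℝ) : ℂ) with huc
  /- the two moments of `v` -/
  set p : ℝ := ∫ t, v t * weilThetaPhi t with hp
  set c : ℝ := ∫ t, v t * Real.cosh (t / 2) with hc
  have hcosh_le : ∀ t ∈ Icc (-a) a, Real.cosh (t / 2) ≤ Real.cosh (a / 2) := fun t ht => by
    rw [Real.cosh_le_cosh, abs_div, abs_div, abs_two, abs_of_pos ha]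
    exact div_le_div_of_nonneg_right (abs_le.2 ⟨ht.1, ht.2⟩) zero_le_two
  have hvΦ_int : Integrable fun t => v t * weilThetaPhi t := by
    refine Integrable.mono' (hv_int.norm.mul_const (weilThetaPhi 0))
      (hv_meas.mul continuous_weilThetaPhi.aestronglyMeasurable)
      (Eventually.of_forall fun t => ?_)
    rw [Real.norm_eq_abs, abs_mul, Real.norm_eq_abs, abs_of_pos (weilThetaPhi_pos t)]
    exact mul_le_mul_of_nonneg_left (gbf_weilThetaPhi_le_zero_val t) (abs_nonneg _)
  have hvc_int : Integrable fun t => v t * Real.cosh (t / 2) := by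
    refine Integrable.mono' (hv_int.norm.mul_const (Real.cosh (a / 2)))
      (hv_meas.mul (by fun_prop : Continuous fun t : ℝ => Real.cosh (t / 2)).aestronglyMeasurable)
      (Eventually.of_forall fun t => ?_)
    rw [Real.norm_eq_abs, abs_mul, Real.norm_eq_abs, abs_of_pos (Real.cosh_pos _)]
    by_cases ht : t ∈ Icc (-a) a
    · exact mul_le_mul_of_nonneg_left (hcosh_le t ht) (abs_nonneg _)
    · rw [hvs t ht, abs_zero, zero_mul, zero_mul]
  -- `p > 0`
  have hp_pos : 0 < p := by
    have hnn : ∀ t, 0 ≤ v t * weilThetaPhi t := fun t => mul_nonneg (hv0 t) (weilThetaPhi_pos t).le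
    have hI : 0 ≤ ∫ t, v t * weilThetaPhi t := integral_nonneg fun t => hnn t
    rcases hI.eq_or_lt with hz | hz'
    · exfalso
      have hvΦ0 : (fun t => v t * weilThetaPhi t) =ᵐ[volume] 0 :=
        (integral_eq_zero_iff_of_nonneg hnn hvΦ_int).1 hz.symm
      have hu0 : ∀ᵐ t : ℝ, u t = 0 := by
        filter_upwards [hvΦ0, hae] with t h0 h1
        simp only [Pi.zero_apply, mul_eq_zero, (weilThetaPhi_pos t).ne', or_false] at h0
        rw [h1, huc]
        simp only [h0, Complex.ofReal_zero]
      have : ∫ t, ‖u t‖ ^ 2 = 0 := by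
        rw [← integral_zero (α := ℝ)]
        exact integral_congr_ae (hu0.mono fun t ht => by simp [ht])
      linarith [hu.integral_norm_sq]
    · exact hz'
  -- `Φ(a) c ≤ cosh(a/2) p`
  have hcp : weilThetaPhi a * c ≤ Real.cosh (a / 2) * p := by
    rw [hc, hp, ← integral_const_mul, ← integral_const_mul]
    refine integral_mono (hvc_int.const_mul _) (hvΦ_int.const_mul _) fun t => ?_
    dsimp only
    by_cases ht : t ∈ Icc (-a) a
    · have h1 : weilThetaPhi a ≤ weilThetaPhi t :=
        gbf_weilThetaPhi_le_of_abs_le (abs_le.2 ⟨ht.1, ht.2⟩)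
      have h2 := hcosh_le t ht
      calc weilThetaPhi a * (v t * Real.cosh (t / 2))
          = v t * (weilThetaPhi a * Real.cosh (t / 2)) := by ring
        _ ≤ v t * (weilThetaPhi t * Real.cosh (a / 2)) :=
          mul_le_mul_of_nonneg_left (mul_le_mul h1 h2 (Real.cosh_pos _).le (weilThetaPhi_pos t).le)
            (hv0 t)
        _ = Real.cosh (a / 2) * (v t * weilThetaPhi t) := by ring
    · rw [hvs t ht]; simp
  /- (1) the inequality at the larger window `a + η`, `0 < η ≤ 1`, IN THE EVEN SECTOR -/
  obtain ⟨C, hC⟩ := stub_cutoffEnergyBound a ha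
  set E : ℝ := |weilEvenGroundEnergy a| + |weilEvenGroundEnergy (a + 1)| with hE
  set C' : ℝ := max C 0 + E * (2 * (a + 1) * weilThetaPhi 0 ^ 2) with hC'
  have hE0 : 0 ≤ E := by positivity
  have hC'0 : 0 ≤ C' := by positivity
  have step : ∀ η : ℝ, 0 < η → η ≤ 1 →
      -(2 * c * groundThetaPolarWeight a) -
          Real.sqrt (weilEvenGroundEnergy a - weilEvenGroundEnergy (a + η)) * Real.sqrt C' ≤
        weilEvenGroundEnergy (a + η) * p := by
    intro η hη hη1
    set b : ℝ := a + η with hb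
    have hb0 : 0 < b := by positivity
    -- the cut-off, the probe and the leakage kernel
    set χ : ℝ → ℝ := fun x => cutoff (a / η + 1) (x / η) with hχ
    set k : ℝ → ℂ := fun t => ((weilThetaPhi t * cutoff (a / η + 1) (t / η) : ℝ) : ℂ) with hk_def
    set κ : ℝ → ℂ := fun t => ((weilThetaPhi t * (1 - χ t) : ℝ) : ℂ) with hκ_def
    have hχc : ContDiff ℝ (⊤ : ℕ∞) χ := gbf_contDiff_cutoff
    have hχs : HasCompactSupport χ := gbf_hasCompactSupport_cutoff hη
    have hχ1 : ∀ t ∈ Icc (-a) a, χ t = 1 := fun t ht => gbf_cutoff_eq_one hη ht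
    have hχ01 : ∀ t, 0 ≤ χ t ∧ χ t ≤ 1 := fun t => ⟨cutoff_nonneg _ _, cutoff_le_one _ _⟩
    have hχe : ∀ t, χ (-t) = χ t := fun t => gbf_cutoff_neg t
    obtain ⟨hk, hks1, hkbd⟩ := cutoffEnergy_test (a := a) hη hη1
    have hks : tsupport k ⊆ Icc (-b) b := by
      refine closure_minimal (fun t ht => ?_) isClosed_Icc
      by_contra h
      apply ht
      have : cutoff (a / η + 1) (t / η) = 0 :=
        gbf_cutoff_eq_zero_of_not_mem hη fun h' => h (Ioo_subset_Icc_self h')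
      simp [hk_def, this]
    -- the probe is EVEN
    have hke : ∀ t, k (-t) = k t := fun t => by
      simp only [hk_def, weilThetaPhi_neg, gbf_cutoff_neg t]
    have hk_sub : k = fun t => ((weilThetaPhi t : ℝ) : ℂ) - κ t := by
      funext t
      simp only [hk_def, hκ_def, hχ]
      push_cast
      ring
    have hk_mem : ∀ {t : ℝ}, t ∈ Icc (-a) a → k t = ((weilThetaPhi t : ℝ) : ℂ) := fun ht => by
      simp [hk_def, gbf_cutoff_eq_one hη ht]
    have hgb : ∀ n, tsupport (g n) ⊆ Icc (-b) b := fun n =>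
      (hg n).2.1.trans (Icc_subset_Icc (by linarith) (by linarith))
    -- the leakage kernel is in the exponential class
    obtain ⟨hκd, hκe⟩ := stub_leakageKernelEnvelope χ hχc hχs
    -- harmonic splitting, limit, sign
    have hsplit : ∀ n, weilFunctional (weilConv (g n) (weilReflect k)) =
        -weilFunctional (weilConv (g n) (weilReflect κ)) := fun n => by
      rw [hk_sub]
      exact stub_harmonicSplit (g n) κ (hg n).1 hκd hκe
    have hlimW : Tendsto (fun n => weilFunctional (weilConv (g n) (weilReflect κ))) atTop
        (𝓝 (weilFunctional (weilConv u (weilReflect κ)))) :=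
      evenFloor_leakageTendsto hu2 hu.ae_eq_zero_of_notMem hg' hL hκd hκe
    have hWu : weilFunctional (weilConv u (weilReflect κ)) =
        weilFunctional (weilConv uc (weilReflect κ)) := by
      rw [gbf_weilConv_congr_ae_left hae]
    have hsignW : (weilFunctional (weilConv uc (weilReflect κ))).re ≤
        2 * c * groundThetaPolarWeight a :=
      stub_leakageSign a v χ ha hv_int hv0 hvs hχ1 hχ01 hχe hκd hκe
    -- the pairing `⟨gₙ, k⟩ → ⟨u, k⟩ = p`
    have hlimP : Tendsto (fun n => ∫ t, g n t * conj (k t)) atTop (𝓝 (∫ t, u t * conj (k t))) :=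
      ConnesVanSuijlekom.tendsto_integral_mul_conj_left (ConnesVanSuijlekom.isWeilTest_memLp hk) hu2
        (fun n => ConnesVanSuijlekom.isWeilTest_memLp (hg n).1) hL
    have hPu : (∫ t, u t * conj (k t)).re = p := by
      have h1 : ∫ t, u t * conj (k t) = ∫ t, ((v t * weilThetaPhi t : ℝ) : ℂ) := by
        refine integral_congr_ae (hae.mono fun t ht => ?_)
        simp only [ht, huc]
        by_cases hm : t ∈ Icc (-a) a
        · rw [hk_mem hm, Complex.conj_ofReal]; push_cast; ring
        · rw [hvs t hm]; simp
      rw [h1, integral_complex_ofReal, Complex.ofReal_re]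
    -- `q_b(gₙ) → ε_ev(a) - ε_ev(b)`
    have hlimQ : Tendsto (fun n => Real.sqrt ((weilQuadratic (g n)).re -
        weilEvenGroundEnergy b * ∫ x, ‖g n x‖ ^ 2)) atTop
        (𝓝 (Real.sqrt (weilEvenGroundEnergy a - weilEvenGroundEnergy b))) := by
      refine ((hQ.sub_const (weilEvenGroundEnergy b)).sqrt).congr fun n => ?_
      rw [(hg n).2.2.2, mul_one]
    -- `q_b(k) ≤ C'`
    have hqk : (weilQuadratic k).re - weilEvenGroundEnergy b * ∫ x, ‖k x‖ ^ 2 ≤ C' := by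
      have h1 : (weilQuadratic k).re ≤ max C 0 := (hC η hη hη1).trans (le_max_left _ _)
      have hI0 : 0 ≤ ∫ x, ‖k x‖ ^ 2 := integral_nonneg fun _ => by positivity
      have hI : ∫ x, ‖k x‖ ^ 2 ≤ 2 * (a + 1) * weilThetaPhi 0 ^ 2 := by
        have hzero : ∀ x, x ∉ Icc (-b) b → ‖k x‖ ^ 2 = 0 := fun x hx => by
          rw [image_eq_zero_of_notMem_tsupport fun h' => hx (hks h'), norm_zero]; ring
        rw [← setIntegral_eq_integral_of_forall_compl_eq_zero (s := Icc (-b) b)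
          (fun x hx => hzero x hx)]
        have hbd : ∀ x ∈ Icc (-b) b, ‖‖k x‖ ^ 2‖ ≤ weilThetaPhi 0 ^ 2 := fun x _ => by
          rw [Real.norm_eq_abs, abs_of_nonneg (by positivity)]
          exact pow_le_pow_left₀ (norm_nonneg _) (hkbd x) 2
        have h2 := norm_setIntegral_le_of_norm_le_const (μ := (volume : Measure ℝ))
          (measure_Icc_lt_top (a := -b) (b := b)) hbd
        rw [Real.volume_real_Icc_of_le (by linarith), show b - -b = 2 * b by ring] at h2
        have h3 : ∫ x in Icc (-b) b, ‖k x‖ ^ 2 ≤ weilThetaPhi 0 ^ 2 * (2 * b) :=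
          (le_abs_self _).trans (by simpa [Real.norm_eq_abs] using h2)
        have h4 : weilThetaPhi 0 ^ 2 * (2 * b) ≤ 2 * (a + 1) * weilThetaPhi 0 ^ 2 := by
          have : b ≤ a + 1 := by linarith
          nlinarith [sq_nonneg (weilThetaPhi 0)]
        exact h3.trans h4
      have hεb : |weilEvenGroundEnergy b| ≤ E := by
        have hlo : weilEvenGroundEnergy (a + 1) ≤ weilEvenGroundEnergy b :=
          weilEvenGroundEnergy_antitoneOn hb0 (show (0 : ℝ) < a + 1 by positivity) (by linarith)
        have hhi : weilEvenGroundEnergy b ≤ weilEvenGroundEnergy a :=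
          weilEvenGroundEnergy_antitoneOn ha hb0 (by linarith)
        rw [hE, abs_le]
        constructor
        · linarith [neg_abs_le (weilEvenGroundEnergy (a + 1)), abs_nonneg (weilEvenGroundEnergy a)]
        · linarith [le_abs_self (weilEvenGroundEnergy a), abs_nonneg (weilEvenGroundEnergy (a + 1))]
      have h5 : -(weilEvenGroundEnergy b * ∫ x, ‖k x‖ ^ 2) ≤
          E * (2 * (a + 1) * weilThetaPhi 0 ^ 2) :=
        calc -(weilEvenGroundEnergy b * ∫ x, ‖k x‖ ^ 2)
            ≤ |weilEvenGroundEnergy b| * ∫ x, ‖k x‖ ^ 2 := by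
              rw [← neg_mul]
              exact mul_le_mul_of_nonneg_right (neg_le_abs _) hI0
          _ ≤ E * (2 * (a + 1) * weilThetaPhi 0 ^ 2) := mul_le_mul hεb hI hI0 hE0
      rw [hC']
      linarith
    -- per-`n` inequality (Cauchy–Schwarz in the EVEN sector of the window `b`)
    have hn : ∀ n, (-(weilFunctional (weilConv (g n) (weilReflect κ)))).re -
        Real.sqrt ((weilQuadratic (g n)).re - weilEvenGroundEnergy b * ∫ x, ‖g n x‖ ^ 2) *
          Real.sqrt C' ≤
        weilEvenGroundEnergy b * (∫ t, g n t * conj (k t)).re := by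
      intro n
      have h1 := evenFloor_re_weilFunctional_sub_sqrt_le_even (hg n).1 (hgb n) (hg n).2.2.1
        hk hks hke
      rw [hsplit n] at h1
      have h2 : Real.sqrt ((weilQuadratic (g n)).re - weilEvenGroundEnergy b * ∫ x, ‖g n x‖ ^ 2) *
          Real.sqrt ((weilQuadratic k).re - weilEvenGroundEnergy b * ∫ x, ‖k x‖ ^ 2) ≤
          Real.sqrt ((weilQuadratic (g n)).re - weilEvenGroundEnergy b * ∫ x, ‖g n x‖ ^ 2) *
            Real.sqrt C' :=
        mul_le_mul_of_nonneg_left (Real.sqrt_le_sqrt hqk) (Real.sqrt_nonneg _)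
      linarith
    -- pass to the limit `n → ∞`
    have hlim_lhs : Tendsto (fun n => (-(weilFunctional (weilConv (g n) (weilReflect κ)))).re -
        Real.sqrt ((weilQuadratic (g n)).re - weilEvenGroundEnergy b * ∫ x, ‖g n x‖ ^ 2) *
          Real.sqrt C') atTop
        (𝓝 ((-(weilFunctional (weilConv u (weilReflect κ)))).re -
          Real.sqrt (weilEvenGroundEnergy a - weilEvenGroundEnergy b) * Real.sqrt C')) :=
      ((Complex.continuous_re.tendsto _).comp hlimW.neg).sub (hlimQ.mul_const _)
    have hlim_rhs : Tendsto (fun n => weilEvenGroundEnergy b * (∫ t, g n t * conj (k t)).re) atTop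
        (𝓝 (weilEvenGroundEnergy b * p)) := by
      rw [← hPu]
      exact ((Complex.continuous_re.tendsto _).comp hlimP).const_mul _
    have hlim := le_of_tendsto_of_tendsto' hlim_lhs hlim_rhs hn
    have h6 : (weilFunctional (weilConv u (weilReflect κ))).re ≤ 2 * c * groundThetaPolarWeight a := by
      rw [hWu]; exact hsignW
    have h7 : (-(weilFunctional (weilConv u (weilReflect κ)))).re =
        -(weilFunctional (weilConv u (weilReflect κ))).re := Complex.neg_re _
    linarith
  /- (2) `η → 0⁺` through the continuity of `ε_ev` -/
  have hη : ∀ m : ℕ, 0 < 1 / ((m : ℝ) + 1) ∧ 1 / ((m : ℝ) + 1) ≤ 1 := fun m =>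
    ⟨by positivity, by rw [div_le_one (by positivity)]; linarith [(Nat.cast_nonneg m : (0 : ℝ) ≤ m)]⟩
  have hten : Tendsto (fun m : ℕ => a + 1 / ((m : ℝ) + 1)) atTop (𝓝 a) := by
    have h := (tendsto_const_nhds (x := a) (f := (atTop : Filter ℕ))).add
      tendsto_one_div_add_atTop_nhds_zero_nat
    rw [add_zero] at h
    exact h
  have hεlim : Tendsto (fun m : ℕ => weilEvenGroundEnergy (a + 1 / ((m : ℝ) + 1))) atTop
      (𝓝 (weilEvenGroundEnergy a)) :=
    (stub_sectorContinuity_continuousAt_even ha).tendsto.comp hten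
  have hΔlim : Tendsto (fun m : ℕ =>
      Real.sqrt (weilEvenGroundEnergy a - weilEvenGroundEnergy (a + 1 / ((m : ℝ) + 1))) *
        Real.sqrt C') atTop (𝓝 0) := by
    have h := (((tendsto_const_nhds (x := weilEvenGroundEnergy a)).sub hεlim).sqrt).mul_const
      (Real.sqrt C')
    simpa using h
  have hfinal : -(2 * c * groundThetaPolarWeight a) ≤ weilEvenGroundEnergy a * p := by
    refine le_of_tendsto_of_tendsto' (b := atTop)
      (f := fun m : ℕ => -(2 * c * groundThetaPolarWeight a) -
        Real.sqrt (weilEvenGroundEnergy a - weilEvenGroundEnergy (a + 1 / ((m : ℝ) + 1))) *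
          Real.sqrt C')
      (g := fun m : ℕ => weilEvenGroundEnergy (a + 1 / ((m : ℝ) + 1)) * p) ?_ (hεlim.mul_const p)
      fun m => step _ (hη m).1 (hη m).2
    simpa using tendsto_const_nhds.sub hΔlim
  /- (3) algebra: `ε_ev p ≥ -2cϖ ≥ -e(a) p` -/
  have hΦa := weilThetaPhi_pos a
  have hϖ := groundThetaPolarWeight_nonneg a
  have h1 : c ≤ Real.cosh (a / 2) * p / weilThetaPhi a := by
    rw [le_div_iff₀ hΦa]; linarith
  have h2 : 2 * c * groundThetaPolarWeight a ≤ groundBartaRate a * p := by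
    have : 2 * c * groundThetaPolarWeight a ≤
        2 * (Real.cosh (a / 2) * p / weilThetaPhi a) * groundThetaPolarWeight a := by gcongr
    refine this.trans (le_of_eq ?_)
    unfold groundBartaRate
    field_simp
  have h3 : -groundBartaRate a * p ≤ weilEvenGroundEnergy a * p := by linarith
  exact le_of_mul_le_mul_right h3 hp_pos

end Summit.RiemannHypothesis.RiemannHypothesis.Theorems.PolarPerronFrobenius

end
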